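import Literature.AlgebraicGeometry.Resolution.RelativeCurveChartSetup
import Literature.AlgebraicGeometry.Resolution.FineModels
import Literature.AlgebraicGeometry.Resolution.NormalizationFractions
import Literature.AlgebraicGeometry.Resolution.KnafKuhlmann2009Lemma21
import Literature.AlgebraicGeometry.Resolution.RoofInField
import HarnessLib

/-!
# The chart datum of Thm. 3.3.1 — I. The approximant of the constant, the fine model, the base ring

Topic: `Literature/AlgebraicGeometry/Resolution`. M. Temkin, *Inseparable local uniformization*,
J. Algebra 373 (2013) = arXiv:0804.1554v3, Thm. 3.3.1, smooth-fibre case (tree: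
`Temkin2013RelativeCurveSmoothFibre`). For a chart datum `C : RelCurveChart k K L₁ Ω`
(`RelativeCurveChartSetup.lean`) this file performs the first constructions of the `K`-side
(D-) chart of the common smooth roof:

* the APPROXIMANT `y ∈ L₁°` of the constant `y₀ ∈ L₁^h` to the Newton precision
  `|y₀ − y| < |P′(y₀)|²`: such approximants EXIST (`exists_y`; `L₁` is dense in its
  henselization: Kuhlmann 2010, Lemma 2.4, tree `exists_mem_valuation_sub_lt_of_isRankOneValued`),
  and for the one recorded in the datum (`y = C.ya`), `|P′(y)| = |P′(y₀)|` and the Newton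
  quotient `β = P(y)/P′(y)² ∈ L₁°` — `y`, `β`, … — PROVED;
* the FINE `K`-RATIONAL MODEL `A′ = Nr_K(k°[s_A, s_fine, g_K]) ≥ A` (`s_fine` from
  `exists_fine_generators` for `W = {x, y, β} ∪ Z`, fixed before the disc; `g_K` the `K`-rational
  cut-out), its normalization `N = Nr_{L₁}(A′) ⊆ L₁°`, the
  `L₁°`-unit `f ∈ N` and the basic open `N″ = N[1/f] ⊆ Ω` (an `N`-subalgebra of `Ω`, smooth over
  `N`, an integrally closed domain, containing `x, y, β, g_K, Z` and `k°`) — PROVED.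

Everything is [folklore] bookkeeping over the cited results; no named facts.

## Sources

* M. Temkin, arXiv:0804.1554v3, proof of Thm. 3.3.1, Steps 2–3 (pp. 44–45).
* F.-V. Kuhlmann, Trans. AMS 362 (2010), Lemma 2.4 (density), through the tree.
-/

noncomputable section

open Polynomial IsLocalRing

namespace Literature.AlgebraicGeometry.Resolution

namespace RelCurveChart

universe u

variable {k K L₁ Ω : Type u} [Field k] [Field K] [Field L₁] [Field Ω]
  [Algebra k K] [Algebra K L₁] [Algebra k L₁] [IsScalarTower k K L₁]
  [Algebra L₁ Ω] [Algebra K Ω] [Algebra k Ω] [IsScalarTower K L₁ Ω] [IsScalarTower k L₁ Ω]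
  [IsAlgClosed Ω] [FiniteDimensional K L₁] (C : RelCurveChart k K L₁ Ω)

/-! ### The minimal polynomial of `y₀`, over `L₁` and over `Ω` -/

/-- `P` over `L₁`. [folklore] -/
def PL : Polynomial L₁ := C.P.map (algebraMap k L₁)

/-- `P` over `Ω`. [folklore] -/
def PΩ : Polynomial Ω := C.P.map (algebraMap k Ω)

/-- `PΩ = PL` mapped. [folklore] -/
theorem PΩ_eq_map : C.PΩ = C.PL.map (algebraMap L₁ Ω) := by
  rw [PΩ, PL, Polynomial.map_map, ← IsScalarTower.algebraMap_eq]

/-- The coefficients of `PΩ` lie in `V` (and in `k`). [folklore] -/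
theorem coeff_PΩ_mem_V (i : ℕ) : C.PΩ.coeff i ∈ C.V := by
  rw [PΩ, coeff_map]
  have h : C.P.coeff i ∈ C.V.comap (algebraMap k Ω) := by rw [C.comap_k]; exact C.hPcoef i
  exact h

/-- `P(y₀) = 0`. [folklore] -/
theorem eval_PΩ_y₀ : C.PΩ.eval C.y₀ = 0 := by
  rw [PΩ, eval_map, ← aeval_def, C.hP]
  exact minpoly.aeval k C.y₀

/-- `P′(y₀) ≠ 0` (separability). [folklore] -/
theorem eval_derivative_PΩ_y₀_ne_zero : (derivative C.PΩ).eval C.y₀ ≠ 0 := by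
  rw [PΩ, derivative_map, eval_map, ← aeval_def]
  have hsep : C.P.Separable := by rw [C.hP]; exact C.hy₀sep
  exact hsep.aeval_derivative_ne_zero (by rw [C.hP]; exact minpoly.aeval k C.y₀)

/-- `|P′(y₀)| ≤ 1`. [folklore] -/
theorem valuation_derivative_y₀_le : C.V.valuation ((derivative C.PΩ).eval C.y₀) ≤ 1 :=
  (C.V.valuation_le_one_iff _).mpr (eval_mem_valuationSubring_of_coeff_mem C.V
    (coeff_derivative_mem_valuationSubring C.V C.coeff_PΩ_mem_V) C.hy₀V)

/-! ### The approximant `y ∈ L₁°` of `y₀` -/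

/-- The coefficients of `PΩ` and of its derivative lie in `k ↦ Ω`. [folklore] -/
theorem coeff_PΩ_mem_kΩ (i : ℕ) : C.PΩ.coeff i ∈ (kΩ (k := k) (Ω := Ω)) := by
  rw [PΩ, coeff_map]
  exact ⟨C.P.coeff i, rfl⟩

/-- `P′(y₀) ∈ m`. [folklore] -/
theorem eval_derivative_y₀_mem_m : (derivative C.PΩ).eval C.y₀ ∈ C.m :=
  eval_mem_subfield_of_coeff_mem
    (fun i => C.kΩ_le_m (coeff_derivative_mem_subfield C.coeff_PΩ_mem_kΩ i)) C.y₀_mem_m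

/-- Elements of `m` are algebraic over `L₁ ↦ Ω` (they lie in the henselization, which lies in
the separable closure). [folklore] -/
theorem isAlgebraic_of_mem_m {z : Ω} (hz : z ∈ C.m) :
    IsAlgebraic (algebraMap L₁ Ω).fieldRange z := by
  have h1 : z ∈ (separableClosure (algebraMap L₁ Ω).fieldRange Ω) :=
    henselization_le_separableClosure C.V _ (C.m_le_L hz)
  exact (mem_separableClosure_iff.mp h1).isIntegral.isAlgebraic

/-- A non-zero element of `L₁` of value at most `|P′(y₀)|²` (the value of `P′(y₀)` is torsion
over the value group of `L₁`). [folklore] -/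
theorem exists_target : ∃ c₁ : Ω, c₁ ∈ (algebraMap L₁ Ω).fieldRange ∧ c₁ ≠ 0 ∧
    C.V.valuation c₁ ≤ C.V.valuation ((derivative C.PΩ).eval C.y₀) ^ 2 := by
  set d := (derivative C.PΩ).eval C.y₀ with hd
  have hd0 : d ≠ 0 := C.eval_derivative_PΩ_y₀_ne_zero
  have hdle : C.V.valuation d ≤ 1 := C.valuation_derivative_y₀_le
  obtain ⟨n, hn, b, hbL, hb⟩ :=
    exists_valuation_pow_eq_of_isAlgebraic C.V (C.isAlgebraic_of_mem_m C.eval_derivative_y₀_mem_m) hd0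
  have hb0 : b ≠ 0 := fun h0 => by
    rw [h0, map_zero, map_pow] at hb
    exact pow_ne_zero n ((Valuation.ne_zero_iff _).mpr hd0) hb
  refine ⟨b ^ 2, pow_mem hbL 2, pow_ne_zero 2 hb0, ?_⟩
  rw [map_pow, ← hb, map_pow, ← pow_mul]
  exact pow_le_pow_right_of_le_one' hdle (by omega)

/-- **The approximant**: some `y ∈ L₁°` has `|y₀ − y| < |P′(y₀)|²`. [cite: Kuhlmann2010, Lemma 2.4] -/
theorem exists_y : ∃ y : L₁, y ∈ C.O₁ ∧
    C.V.valuation (C.y₀ - algebraMap L₁ Ω y) < C.V.valuation ((derivative C.PΩ).eval C.y₀) ^ 2 := by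
  obtain ⟨c₁, hc₁L, hc₁0, hc₁le⟩ := C.exists_target
  obtain ⟨yΩ, ⟨y, rfl⟩, hy⟩ :=
    exists_mem_valuation_sub_lt_of_isRankOneValued C.hrank C.hy₀h hc₁L hc₁0
  refine ⟨y, ?_, lt_of_lt_of_le hy hc₁le⟩
  -- `|y| ≤ max(|y₀|, |y₀ − y|) ≤ 1`
  have hyV : algebraMap L₁ Ω y ∈ C.V := by
    have h1 : C.V.valuation (C.y₀ - algebraMap L₁ Ω y) ≤ 1 :=
      (lt_of_lt_of_le hy hc₁le).le.trans
        ((pow_le_one₀ zero_le C.valuation_derivative_y₀_le))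
    have h2 : algebraMap L₁ Ω y = C.y₀ - (C.y₀ - algebraMap L₁ Ω y) := by ring
    rw [← C.V.valuation_le_one_iff, h2]
    exact (Valuation.map_sub _ _ _).trans (max_le ((C.V.valuation_le_one_iff _).mpr C.hy₀V) h1)
  have : y ∈ C.V.comap (algebraMap L₁ Ω) := hyV
  rwa [C.hV] at this

/-- The approximant `y ∈ L₁°` (the field `ya` of the datum; `exists_y` shows how to produce
one). [folklore] -/
def y : L₁ := C.ya

/-- `y ∈ L₁°`. [folklore] -/
theorem y_mem : C.y ∈ C.O₁ := C.hya

/-- `|y₀ − y| < |P′(y₀)|²`. [folklore] -/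
theorem valuation_y₀_sub_y_lt :
    C.V.valuation (C.y₀ - algebraMap L₁ Ω C.y) < C.V.valuation ((derivative C.PΩ).eval C.y₀) ^ 2 := by
  have h := C.hya_lt
  rwa [PΩ, derivative_map, eval_map, ← aeval_def]

/-! ### Newton data at the approximant: `a = P′(y)`, `β = P(y)/a²` -/

/-- `y` as an element of `Ω`. [folklore] -/
def yΩ : Ω := algebraMap L₁ Ω C.y

/-- `y ∈ O_V`. [folklore] -/
theorem yΩ_mem_V : C.yΩ ∈ C.V := by
  have h : C.y ∈ C.V.comap (algebraMap L₁ Ω) := by rw [C.hV]; exact C.y_mem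
  exact h

/-- `a = P′(y) ∈ L₁`. [folklore] -/
def aL : L₁ := (derivative C.PL).eval C.y

omit [IsAlgClosed Ω] in
/-- Pushing evaluation of an `L₁`-polynomial to `Ω`. [folklore] -/
theorem algebraMap_eval (Q : Polynomial L₁) (w : L₁) :
    algebraMap L₁ Ω (Q.eval w) = (Q.map (algebraMap L₁ Ω)).eval (algebraMap L₁ Ω w) := by
  rw [← Polynomial.coe_aeval_eq_eval, ← Polynomial.aeval_algebraMap_apply, Polynomial.aeval_def,
    Polynomial.eval_map]

/-- `a ↦ P′(y)` in `Ω`. [folklore] -/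
theorem algebraMap_aL : algebraMap L₁ Ω C.aL = (derivative C.PΩ).eval C.yΩ := by
  rw [aL, algebraMap_eval, ← derivative_map, ← PΩ_eq_map]
  rfl

/-- `P(y) ↦ PΩ(yΩ)`. [folklore] -/
theorem algebraMap_PL_eval : algebraMap L₁ Ω (C.PL.eval C.y) = C.PΩ.eval C.yΩ := by
  rw [algebraMap_eval, ← PΩ_eq_map]
  rfl

/-- `|P′(y)| = |P′(y₀)|` (the approximant is closer than `|P′(y₀)|`). [folklore] -/
theorem valuation_aL : C.V.valuation (algebraMap L₁ Ω C.aL) =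
    C.V.valuation ((derivative C.PΩ).eval C.y₀) := by
  rw [algebraMap_aL]
  set d₀ := (derivative C.PΩ).eval C.y₀ with hd₀
  have hcoef : ∀ i, (derivative C.PΩ).coeff i ∈ C.V :=
    coeff_derivative_mem_valuationSubring C.V C.coeff_PΩ_mem_V
  have h1 : C.V.valuation ((derivative C.PΩ).eval C.yΩ - d₀) < C.V.valuation d₀ := by
    calc C.V.valuation ((derivative C.PΩ).eval C.yΩ - d₀)
        ≤ C.V.valuation (C.yΩ - C.y₀) := valuation_eval_sub_eval_le C.V hcoef C.yΩ_mem_V C.hy₀V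
      _ = C.V.valuation (C.y₀ - C.yΩ) := Valuation.map_sub_swap _ _ _
      _ < C.V.valuation d₀ ^ 2 := C.valuation_y₀_sub_y_lt
      _ ≤ C.V.valuation d₀ := pow_le_of_le_one zero_le C.valuation_derivative_y₀_le (by norm_num)
  have h2 : (derivative C.PΩ).eval C.yΩ = d₀ + ((derivative C.PΩ).eval C.yΩ - d₀) := by ring
  rw [h2]
  exact Valuation.map_add_eq_of_lt_left _ h1

/-- `a = P′(y) ≠ 0`. [folklore] -/
theorem aL_ne_zero : C.aL ≠ 0 := fun h0 => by
  have h := C.valuation_aL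
  rw [h0, map_zero, map_zero, eq_comm, map_eq_zero] at h
  exact C.eval_derivative_PΩ_y₀_ne_zero h

/-- The Newton quotient `β = P(y)/P′(y)²`. [folklore] -/
def βL : L₁ := C.PL.eval C.y / C.aL ^ 2

/-- `P(y) = P′(y)² β`. [folklore] -/
theorem PL_eval_eq : C.PL.eval C.y = C.aL ^ 2 * C.βL := by
  rw [βL, mul_div_cancel₀ _ (pow_ne_zero 2 C.aL_ne_zero)]

/-- `|β| < 1`; in particular `β ∈ L₁°`. [folklore] -/
theorem valuation_βL_lt_one : C.V.valuation (algebraMap L₁ Ω C.βL) < 1 := by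
  have ha0 : C.V.valuation (algebraMap L₁ Ω C.aL) ≠ 0 :=
    (Valuation.ne_zero_iff _).mpr ((_root_.map_ne_zero _).mpr C.aL_ne_zero)
  have hP : C.V.valuation (C.PΩ.eval C.yΩ) < C.V.valuation (algebraMap L₁ Ω C.aL) ^ 2 := by
    calc C.V.valuation (C.PΩ.eval C.yΩ) = C.V.valuation (C.PΩ.eval C.yΩ - C.PΩ.eval C.y₀) := by
          rw [C.eval_PΩ_y₀, sub_zero]
      _ ≤ C.V.valuation (C.yΩ - C.y₀) := valuation_eval_sub_eval_le C.V C.coeff_PΩ_mem_V C.yΩ_mem_V C.hy₀V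
      _ = C.V.valuation (C.y₀ - C.yΩ) := Valuation.map_sub_swap _ _ _
      _ < C.V.valuation ((derivative C.PΩ).eval C.y₀) ^ 2 := C.valuation_y₀_sub_y_lt
      _ = C.V.valuation (algebraMap L₁ Ω C.aL) ^ 2 := by rw [C.valuation_aL]
  rw [βL, map_div₀, map_pow, C.algebraMap_PL_eval, map_div₀, map_pow,
    div_lt_one₀ (pow_pos ((Valuation.pos_iff _).mpr ((_root_.map_ne_zero _).mpr C.aL_ne_zero)) 2)]
  exact hP

/-- `β ∈ L₁°`. [folklore] -/
theorem βL_mem : C.βL ∈ C.O₁ := by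
  have h : algebraMap L₁ Ω C.βL ∈ C.V := (C.V.valuation_le_one_iff _).mp C.valuation_βL_lt_one.le
  have h' : C.βL ∈ C.V.comap (algebraMap L₁ Ω) := h
  rwa [C.hV] at h'

/-! ### The fine `K`-rational model `A′`, its normalization `N`, the unit `f` -/

/-- `k° ↦ K` lies in `K°`. [folklore] -/
theorem R₀_le_O : C.R₀ ≤ C.O.toSubring := by
  rintro _ ⟨c₀, hc₀, rfl⟩
  have : c₀ ∈ C.O.comap (algebraMap k K) := by rw [C.hO]; exact hc₀
  exact this

/-- `K°` has finite height. [folklore] -/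
theorem ringKrullDim_O_lt_top : ringKrullDim C.O < ⊤ := by rw [C.hdimK]; decide

/-- The set `W = {x, y, β} ∪ Z ⊆ L₁°` of elements to be made regular on the model (it depends
only on the data fixed before the disc). [folklore] -/
def Wset : Finset L₁ := by classical exact insert C.x (insert C.y (insert C.βL C.Z))

/-- `W ⊆ L₁°`. [folklore] -/
theorem Wset_subset : (↑C.Wset : Set L₁) ⊆ (C.O₁ : Set L₁) := by
  classical
  intro w hw
  simp only [Wset, Finset.coe_insert, Set.mem_insert_iff, Finset.mem_coe] at hw
  rcases hw with rfl | rfl | rfl | hw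
  · exact C.hx
  · exact C.y_mem
  · exact C.βL_mem
  · exact C.hZ hw

/-- Membership in `W`. [folklore] -/
theorem mem_Wset_iff {w : L₁} : w ∈ C.Wset ↔ (w = C.x ∨ w = C.y ∨ w = C.βL ∨ w ∈ C.Z) := by
  classical
  simp only [Wset, Finset.mem_insert]

/-- **Fine generators** (model-free): finitely many `s_fine ⊆ K°` and a unit `f` of `L₁°` such
that `W ⊆ Nr_{L₁}(A″)[1/f]` for every subring `A″ ⊇ s_fine` of `K`. [folklore] -/
theorem exists_gens : ∃ (s' : Finset K) (f : L₁), (↑s' : Set K) ⊆ (C.O : Set K) ∧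
    C.O₁.valuation f = 1 ∧ ∀ A'' : Subring K, (↑s' : Set K) ⊆ A'' →
      f ∈ nrIn (A''.map (algebraMap K L₁)) ∧
      ∀ w ∈ C.Wset, ∃ a ∈ nrIn (A''.map (algebraMap K L₁)), ∃ n : ℕ, w = a / f ^ n :=
  exists_fine_generators C.O C.ringKrullDim_O_lt_top C.O₁ C.hO₁ C.Wset C.Wset_subset

/-- The fine generators `s_fine ⊆ K°`. [folklore] -/
def sfine : Finset K := C.exists_gens.choose

/-- The unit `f ∈ L₁`. [folklore] -/
def fL : L₁ := C.exists_gens.choose_spec.choose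

/-- `s_fine ⊆ K°`. [folklore] -/
theorem sfine_subset_O : (↑C.sfine : Set K) ⊆ (C.O : Set K) := C.exists_gens.choose_spec.choose_spec.1

/-- `|f| = 1`. [folklore] -/
theorem valuation_fL : C.O₁.valuation C.fL = 1 := C.exists_gens.choose_spec.choose_spec.2.1

/-- The defining property of `s_fine, f`. [folklore] -/
theorem gens_spec (A'' : Subring K) (h : (↑C.sfine : Set K) ⊆ A'') :
    C.fL ∈ nrIn (A''.map (algebraMap K L₁)) ∧
      ∀ w ∈ C.Wset, ∃ a ∈ nrIn (A''.map (algebraMap K L₁)), ∃ n : ℕ, w = a / C.fL ^ n :=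
  C.exists_gens.choose_spec.choose_spec.2.2 A'' h

/-- The generators `s_A ⊆ K°` of the given model `A = Nr_K(k°[s_A])`. [folklore] -/
def sA : Finset K := C.hA.choose

/-- `s_A ⊆ K°`. [folklore] -/
theorem sA_subset_O : (↑C.sA : Set K) ⊆ (C.O : Set K) := C.hA.choose_spec.1

/-- `A = Nr_K(k°[s_A])`. [folklore] -/
theorem coe_A_eq : (C.A : Set K) = {z : K | IsIntegral (Subring.closure ((C.R₀ : Set K) ∪ ↑C.sA)) z} :=
  C.hA.choose_spec.2.1

/-- `Frac A = K`. [folklore] -/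
theorem frac_A : ∀ z : K, ∃ a ∈ C.A, ∃ b ∈ C.A, z = a / b := C.hA.choose_spec.2.2

/-- ALL the generators of the fine model: `s_A ∪ s_fine ∪ {g_K}`. [folklore] -/
def sAll : Finset K := by classical exact C.sA ∪ C.sfine ∪ {C.gK}

/-- Membership in `sAll`. [folklore] -/
theorem mem_sAll_iff {z : K} : z ∈ C.sAll ↔ (z ∈ C.sA ∨ z ∈ C.sfine ∨ z = C.gK) := by
  classical
  simp only [sAll, Finset.mem_union, Finset.mem_singleton, or_assoc]

/-- `sAll ⊆ K°`. [folklore] -/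
theorem sAll_subset_O : (↑C.sAll : Set K) ⊆ (C.O : Set K) := by
  intro z hz
  rcases C.mem_sAll_iff.mp hz with h | h | rfl
  · exact C.sA_subset_O h
  · exact C.sfine_subset_O h
  · exact C.hgK

/-- **The fine model `A′ = Nr_K(k°[s_A, s_fine, g_K])`.** [folklore] -/
def A' : Subring K := nrIn (Subring.closure ((C.R₀ : Set K) ∪ ↑C.sAll))

/-- `sAll ⊆ A′`. [folklore] -/
theorem sAll_subset_A' : (↑C.sAll : Set K) ⊆ (C.A' : Set K) := fun _ hz =>
  le_nrIn _ (Subring.subset_closure (Or.inr hz))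

/-- `A ≤ A′`. [folklore] -/
theorem A_le_A' : C.A ≤ C.A' := by
  rw [A', eq_nrIn_of_coe_eq C.coe_A_eq]
  refine nrIn_mono (Subring.closure_mono (Set.union_subset_union_right _ fun _ hz => ?_))
  exact C.mem_sAll_iff.mpr (Or.inl hz)

/-- `A′` is an affine normalized model of `K°` over `k°`. [folklore] -/
theorem A'_model : IsAffineNormalizedModel C.O C.R₀ C.A' :=
  ⟨C.sAll, C.sAll_subset_O, coe_nrIn _, fun z => by
    obtain ⟨a, ha, b, hb, rfl⟩ := C.frac_A z
    exact ⟨a, C.A_le_A' ha, b, C.A_le_A' hb, rfl⟩⟩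

/-- `g_K ∈ A′`. [folklore] -/
theorem gK_mem_A' : C.gK ∈ C.A' := C.sAll_subset_A' (C.mem_sAll_iff.mpr (Or.inr (Or.inr rfl)))

/-- `A′ ⊆ K°`. [folklore] -/
theorem A'_le_O : C.A' ≤ C.O.toSubring := (C.A'_model.le_and_le C.R₀_le_O).1

/-- `k° ⊆ A′`. [folklore] -/
theorem R₀_le_A' : C.R₀ ≤ C.A' := (C.A'_model.le_and_le C.R₀_le_O).2

/-- The normalization `N = Nr_{L₁}(A′) ⊆ L₁`. [folklore] -/
def N : Subring L₁ := nrIn (C.A'.map (algebraMap K L₁))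

/-- `f ∈ N`. [folklore] -/
theorem fL_mem_N : C.fL ∈ C.N :=
  (C.gens_spec C.A' fun _ hz => C.sAll_subset_A' (C.mem_sAll_iff.mpr (Or.inr (Or.inl hz)))).1

/-- Each of `x, y, β` and the elements of `Z` is `a / fⁿ` with `a ∈ N`. [folklore] -/
theorem repr_of {w : L₁} (hw : w = C.x ∨ w = C.y ∨ w = C.βL ∨ w ∈ C.Z) :
    ∃ a ∈ C.N, ∃ n : ℕ, w = a / C.fL ^ n :=
  (C.gens_spec C.A' fun _ hz => C.sAll_subset_A' (C.mem_sAll_iff.mpr (Or.inr (Or.inl hz)))).2 w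
    (C.mem_Wset_iff.mpr hw)

/-- `N ⊆ L₁°`. [folklore] -/
theorem N_le_O₁ : C.N ≤ C.O₁.toSubring := nrIn_map_le_valuationSubring C.A'_le_O C.O₁ C.hO₁

/-- `A′ ↦ N`. [folklore] -/
theorem algebraMap_mem_N {w : K} (hw : w ∈ C.A') : algebraMap K L₁ w ∈ C.N :=
  le_nrIn _ (Subring.mem_map.mpr ⟨w, hw, rfl⟩)

/-- `Frac N = L₁`: every element of `L₁` is a quotient of elements of `N`. [folklore] -/
theorem exists_div_N (z : L₁) : ∃ a ∈ C.N, ∃ b ∈ C.N, b ≠ 0 ∧ z = a / b := by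
  obtain ⟨s, -, -, hfr⟩ := C.A'_model
  exact exists_div_nrIn C.A' hfr z

/-- `N` is an integrally closed domain. [folklore] -/
theorem isIntegrallyClosed_N : IsIntegrallyClosed C.N :=
  isIntegrallyClosed_nrIn _ fun z => by
    obtain ⟨a, ha, b, hb, -, h⟩ := C.exists_div_N z
    exact ⟨a, ha, b, hb, h⟩

/-! ### The base ring `N″ = N[1/f] ⊆ Ω` -/

/-- `f` in `Ω`. [folklore] -/
def fΩ : Ω := algebraMap L₁ Ω C.fL

/-- `f ≠ 0`. [folklore] -/
theorem fL_ne_zero : C.fL ≠ 0 := fun h0 => by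
  have h := C.valuation_fL
  rw [h0, map_zero] at h
  exact zero_ne_one h

/-- `fΩ ≠ 0`. [folklore] -/
theorem fΩ_ne_zero : C.fΩ ≠ 0 := (_root_.map_ne_zero _).mpr C.fL_ne_zero

/-- `|fΩ| = 1`. [folklore] -/
theorem valuation_fΩ : C.V.valuation C.fΩ = 1 := by
  have hf : C.fL ∈ C.O₁ := (C.O₁.valuation_le_one_iff _).mp C.valuation_fL.le
  have hfinv : C.fL⁻¹ ∈ C.O₁ :=
    (C.O₁.valuation_le_one_iff _).mp (by rw [map_inv₀, C.valuation_fL, inv_one])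
  have h1 : C.fΩ ∈ C.V := by
    have : C.fL ∈ C.V.comap (algebraMap L₁ Ω) := by rw [C.hV]; exact hf
    exact this
  have h2 : C.fΩ⁻¹ ∈ C.V := by
    have : C.fL⁻¹ ∈ C.V.comap (algebraMap L₁ Ω) := by rw [C.hV]; exact hfinv
    rw [fΩ, ← map_inv₀]
    exact this
  refine le_antisymm ((C.V.valuation_le_one_iff _).mpr h1) ?_
  have h3 := (C.V.valuation_le_one_iff _).mpr h2
  rwa [map_inv₀, inv_le_one₀ ((Valuation.pos_iff _).mpr C.fΩ_ne_zero)] at h3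

/-- `fΩ` lies in the image `⊥` of `N` in `Ω`. [folklore] -/
theorem fΩ_mem_bot : C.fΩ ∈ (⊥ : Subalgebra C.N Ω) :=
  Algebra.mem_bot.mpr ⟨⟨C.fL, C.fL_mem_N⟩, rfl⟩

/-- **The base ring `N″ = N[1/f] ⊆ Ω`** of the `K`-side chart, as an `N`-subalgebra of `Ω`.
[folklore] -/
def N'' : Subalgebra C.N Ω := locAway (⊥ : Subalgebra C.N Ω) C.fΩ C.fΩ_mem_bot

/-- `N → Ω` is injective. [folklore] -/
theorem algebraMap_N_injective : Function.Injective (algebraMap C.N Ω) :=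
  (algebraMap L₁ Ω).injective.comp Subtype.val_injective

/-- `N″` is smooth over `N` (localization away from one element of `N ≅ ⊥`). [folklore] -/
theorem smooth_N'' : Algebra.Smooth C.N C.N'' := by
  haveI : Algebra.Smooth C.N C.N := ⟨inferInstance, inferInstance⟩
  haveI : Algebra.Smooth C.N (⊥ : Subalgebra C.N Ω) :=
    Algebra.Smooth.of_equiv (Algebra.botEquivOfInjective C.algebraMap_N_injective).symm
  exact smooth_locAway_of_smooth C.fΩ_ne_zero

/-- `⊥ ⊆ V` (the image of `N ⊆ L₁°`). [folklore] -/
theorem bot_le_V : (⊥ : Subalgebra C.N Ω).toSubring ≤ C.V.toSubring := by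
  intro w hw
  obtain ⟨⟨n, hn⟩, rfl⟩ := Algebra.mem_bot.mp hw
  have h : (n : L₁) ∈ C.V.comap (algebraMap L₁ Ω) := by rw [C.hV]; exact C.N_le_O₁ hn
  exact h

/-- `N″ ⊆ O_V`. [folklore] -/
theorem N''_le_V : C.N''.toSubring ≤ C.V.toSubring :=
  locAway_le_valuationSubring C.bot_le_V C.valuation_fΩ

/-- `N″` is an integrally closed domain. [folklore] -/
theorem isIntegrallyClosed_N'' : IsIntegrallyClosed C.N'' := by
  change IsIntegrallyClosed (locAway (⊥ : Subalgebra C.N Ω) C.fΩ C.fΩ_mem_bot)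
  haveI : IsIntegrallyClosed C.N := C.isIntegrallyClosed_N
  haveI : IsIntegrallyClosed (⊥ : Subalgebra C.N Ω) :=
    IsIntegrallyClosed.of_equiv
      (Algebra.botEquivOfInjective C.algebraMap_N_injective).symm.toRingEquiv
  letI := (Subalgebra.inclusion (le_locAway (B := (⊥ : Subalgebra C.N Ω)) (f := C.fΩ)
    (hf := C.fΩ_mem_bot))).toRingHom.toAlgebra
  haveI := isLocalization_locAway (B := (⊥ : Subalgebra C.N Ω)) (hf := C.fΩ_mem_bot) C.fΩ_ne_zero
  refine isIntegrallyClosed_of_isLocalization (locAway (⊥ : Subalgebra C.N Ω) C.fΩ C.fΩ_mem_bot)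
    (Submonoid.powers (⟨C.fΩ, C.fΩ_mem_bot⟩ : (⊥ : Subalgebra C.N Ω))) (fun w hw => ?_)
  obtain ⟨n, rfl⟩ := (Submonoid.mem_powers_iff _ _).mp hw
  exact mem_nonZeroDivisors_of_ne_zero (pow_ne_zero n fun h0 =>
    C.fΩ_ne_zero (congrArg Subtype.val h0))

/-- `fΩ⁻¹ ∈ N″`. [folklore] -/
theorem fΩ_inv_mem : C.fΩ⁻¹ ∈ C.N'' := inv_mem_locAway C.fΩ_ne_zero

/-- `N ↦ N″`. [folklore] -/
theorem algebraMap_mem_N'' {w : L₁} (hw : w ∈ C.N) : algebraMap L₁ Ω w ∈ C.N'' :=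
  le_locAway (Algebra.mem_bot.mpr ⟨⟨w, hw⟩, rfl⟩)

/-- Each of `x, y, β, Z` lies in `N″` (as an element of `Ω`). [folklore] -/
theorem algebraMap_mem_N''_of {w : L₁} (hw : w = C.x ∨ w = C.y ∨ w = C.βL ∨ w ∈ C.Z) :
    algebraMap L₁ Ω w ∈ C.N'' := by
  obtain ⟨a, ha, n, rfl⟩ := C.repr_of hw
  rw [map_div₀, map_pow, div_eq_mul_inv, ← inv_pow]
  exact C.N''.mul_mem (C.algebraMap_mem_N'' ha) (C.N''.pow_mem C.fΩ_inv_mem n)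

/-- `x ∈ N″`. [folklore] -/
theorem xΩ_mem_N'' : C.xΩ ∈ C.N'' := C.algebraMap_mem_N''_of (Or.inl rfl)

/-- `y ∈ N″`. [folklore] -/
theorem yΩ_mem_N'' : C.yΩ ∈ C.N'' := C.algebraMap_mem_N''_of (Or.inr (Or.inl rfl))

/-- `β ∈ N″`. [folklore] -/
theorem βΩ_mem_N'' : algebraMap L₁ Ω C.βL ∈ C.N'' :=
  C.algebraMap_mem_N''_of (Or.inr (Or.inr (Or.inl rfl)))

/-- `Z ⊆ N″`. [folklore] -/
theorem algebraMap_mem_N''_of_mem_Z {w : L₁} (hw : w ∈ C.Z) : algebraMap L₁ Ω w ∈ C.N'' :=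
  C.algebraMap_mem_N''_of (Or.inr (Or.inr (Or.inr hw)))

/-- `g_K ∈ N″`. [folklore] -/
theorem gKΩ_mem_N'' : algebraMap K Ω C.gK ∈ C.N'' := by
  rw [IsScalarTower.algebraMap_apply K L₁ Ω]
  exact C.algebraMap_mem_N'' (C.algebraMap_mem_N C.gK_mem_A')

/-- `k° ⊆ N″`. [folklore] -/
theorem algebraMap_mem_N''_of_mem_Ok {c₀ : k} (hc₀ : c₀ ∈ C.Ok) : algebraMap k Ω c₀ ∈ C.N'' := by
  rw [IsScalarTower.algebraMap_apply k L₁ Ω, IsScalarTower.algebraMap_apply k K L₁]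
  exact C.algebraMap_mem_N'' (C.algebraMap_mem_N (C.R₀_le_A' ⟨c₀, hc₀, rfl⟩))

end RelCurveChart

end Literature.AlgebraicGeometry.Resolution

end
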